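import Literature.MathematicalPhysics.QuantumFieldTheory.Balaban1983to89.T4TermFormat

/-!
# T4Relinearisation — the FUNCTION-LEVEL re-linearisation bookkeeping of a carried term (T4-DAG v4 §5, row
T4-O3.E-i′-Oγ2°; obligation O-γ2 of GAPS G-pv16g4-7 (γ2) / G-pv16g4-8 (2))

Cell `pub-balaban` (audit/reconstruction of Bałaban's lattice Yang–Mills series; host summit YangMills; NOT summit
work).  Row text (T4-DAG v4 §5, verbatim): "obligation O-γ2 (G-pv16g4-7 (γ2), G-pv16g4-8): the SCALE-BY-SCALE
re-linearisation bookkeeping — a term born at j and felt at k > j is re-expanded around the scale-k background; type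
the two-index size s j k and the later-scale size/carrier link `T4TermFormat` leaves abstract (Carrier.BirthSizeDominates
⇒ SizeBound at k via `sizeBound_of_step`), and show the (γ) absorbed part stays InCurrency at every k (exact Gaussian)
while the (α)/(β) parts pick up exactly one factor θ₁ per level = `tubeBudget_of_rate`'s hypothesis; why it might
fail: the re-linearisation error at level k is second order in the fluctuation but FIRST order in μ with a k-dependent
constant".

HONEST FRAMING.  This module is PROGRAMME BOOKKEEPING of the cell, not a formalisation of a printed theorem.
Bałaban's papers contain NO loop-dressed observable terms; the objects below (a carried term's value as a function
of the scale-k bond fluctuation field, its re-expansion around the scale-k background, the response norm, the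
transport rate) are the cell's own (T4-REF-O3 V4/V5, T4-DAG v4 §5 and §8 Q14), typed so that the ARRAY-level budgets
of `T4TermFormat` / `T4TubeBudget` receive their inputs from FUNCTION-level facts.  Every estimate that is not
elementary algebra is a HYPOTHESIS SHAPE (`def … : Prop`), never asserted; the theorems are kernel-checked
bookkeeping (currency additivity, sup bounds on a polydisc, the exact integration identity, the geometric transport
of a one-step rate, the failure of a K-uniform currency slot without decay).  Nothing here is summit progress.

PRINTED CONTEXT (B13 = [Balaban1988RG2Cluster], journal page = PDF page; transcribed from the page renders
`1988-cmp116-rg-II-cluster-p002/p007/p008/p009/p010/p011/p016-x2.png` read by the author of this file; CONTEXT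
ONLY — no statement below cites these passages as its source).
* Re-expansion of an old term around the new background, §1 p. 2: «there exists a function E(X, U, J, A) analytic
  and localized to X in U, J, A, such that a given term is obtained substituting a proper nonlocal expression in
  the place of A» …; «Substituting A = (tζ̃_□ + t_□ζ_□)H_k(B′) (1.1) we introduce, through the function H_k(B′), a
  dependence on U, J, B on the whole lattice. Our problem is to localize the obtained function, more precisely to
  represent it as a sum of terms, which are localized in domains from D_k, and which satisfy bounds of the type
  (I.1.18).», with «H_k(B′) = H₀B′ + A₀ − HD(H₀B′ + A₀), (1.2)».
* First order in the fluctuation field, by a Cauchy formula, p. 7: «|H_k(s(Y₀), B′)| ≤ 4B₀C₁e^{16κ₁}g_k|B| <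
  4B₀C₁e^{16κ₁}ε₁, (1.21)», «We differentiate it with respect to t_□, at t_□ = 0, and we represent all derivatives
  by the Cauchy formula.»; p. 8: «Another possibility is to use the expression g_k|B| instead of ε₁. It gives a
  better bound, but the above is simpler.» and «These considerations and bounds were done on the example of the last
  term on the right-hand side of (I.3.34), but almost all of them are quite general and can be applied to all terms
  in the fluctuation field action.»
* Earlier-scale terms counted against a per-level factor, p. 8: «To bound the first sum, over □′ ⊂ □̃², we use the
  factor (L^jη)⁵ in (1.24). This yields (6L)⁴L^jη, and the sum over j is bounded by 2(6L)⁴.»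
* The localized, re-expanded earlier action, p. 9, Lemma 1: «The second expression in the fluctuation field action
  in (I.2.13) is represented as the sum E_k(U_k(exp iB′V^(k))) − E_k(U_k(V^(k))) = Σ_{Y∈D_k} V′_k(Y, U_{k+1}, B).
  (1.33) For each term in the sum there exists a function V′_k(Y, U, J, B), defined and analytic on the space
  U^c_{k+1}(Y, (1 + β)α₀, (1 + β)α₁, α₀) × {B : |B| < ε₁g_k⁻¹ on Y}, (1.34)» … «There exist absolute constants C₁,
  C₂, q, for which |V′_k(Y, U, J, B)| ≤ E₀ε₁C₁M^q exp C₂κ₁ exp(−(1 − 2δ)κd_k(Y)). (1.36)»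
* Second order by Taylor expansion, p. 10: «To cancel the factor 1/g_k² we expand (1.38) with respect to B′ up to
  the second order. The terms of zeroth and first order vanish, and the second order term is written as a quadratic
  form with coefficients given by second order derivatives of the function (1.38).»; p. 11, Lemma 2: «This function
  is a sum of two terms V_k(Y, B) = ½⟨Q(Y, B), B, B⟩ + V″_k(Y, B). (1.42) The matrix elements of the operator of the
  quadratic form satisfy the bound |Q(Y, B, b, b′)| ≤ C₃ε₁M⁴ exp C₂κ₁ exp(−⅛(κ₁ − 1)d_k(Y) − ½(κ₁ − 1)M⁻⁴|Y|),
  (1.43) and the function V″_k(Y, B) satisfies the bound (1.36).»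
* The two currencies, §2 p. 16: «Similarly, the next Gaussian measure is replaced by the measure with the new
  covariance», and «Σ_{Y∈D} |τ(Y)||V_k(Y, B)| ≤ ½ Σ_{b,b′⊂Y₀} α₄M⁻⁴exp(−(1/16)(κ₁ − 1)M⁻¹|b₋ − b′₋|)|B(b)||B(b′)| +
  Σ_{Y∈D} α₄exp(−δκd_k(Y)) ≤ ½O(1)α₄ Σ_{b⊂Y₀} |B(b)|² + O(1)α₄M⁻⁴|Y₀|. (2.20)».
In print, then, the earlier effective action re-expanded at scale k has the shape (1.42): a quadratic form in the
fluctuation field with ε₁-small matrix elements plus a part bounded absolutely, charged to the quadratic and to the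
constant currency of (2.20); the smallness ε₁ and the localization factors exp(−κd_k) are properties of BAŁABAN's
terms.  The cell's question O-γ2 is what the same re-expansion costs for ITS carried terms, whose coefficients are
first order in the source parameter μ and carry no exp(−κd_k); that cost is NOT in print and is NOT asserted here.

WHAT IS TYPED (elementary throughout; tag [folklore] = standard analysis / pure bookkeeping).
§1 One re-expansion.  For a real-valued carried piece `f : (β → E) → ℝ` of the bond field (`E` a real inner
   product space; a complex weight is pulled out as a real `t`, real and imaginary parts being booked separately,
   as in `T4FirstOrderSize`): `flucPart f = f − f 0`; `relinRem f t S a = f − f 0 − linTerm t S a` (the second-order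
   remainder after re-linearising with coefficient field `a` on the bond set `S`); hypothesis shapes `AmpBound`
   (‖a b‖ ≤ A), `RemBound` (|rem B| ≤ (q/2)·Σ_{b∈S}‖B b‖², the (1.42)-type quadratic form; for the cell's terms
   q is FIRST ORDER in |μ|), `SmallField` (the polydisc ‖B b‖ ≤ ρ on S, printed twin (1.34)).  KERNEL:
   `inCurrency_add`; `inCurrency_flucPart` — (γ) THE FLUCTUATION-DEPENDENT PART IS IN CURRENCY AT EVERY
   RE-EXPANSION, with quadratic draw η + q and constant cost (tA)²/(2η) (`T4FirstOrderSize.linearAbsorbed_of_amplitude`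
   plus the remainder's own draw); `abs_flucPart_le`: on the polydisc, |flucPart f B| ≤ `respNorm t |S| A q ρ =
   |t|·(|S|·A·ρ) + (q/2)·(|S|·ρ²)` — THE RESPONSE NORM, the typed two-index size of a term at a later scale.
§2 One integration.  `integral_flucPart`: ∫ flucPart f (B ω) dP = linTerm t S a (meanField P B) + ∫ rem (exact;
   under `MeanVanishes` the linear part integrates to 0 — the centred Gaussian step); `abs_integral_le_of_remBound`
   (second moments ≤ v ⇒ |∫ rem| ≤ (q/2)·|S|·v: the diagonal second-order correction (γ1), first order in μ
   through q); `abs_integral_flucPart_le` (+ |t|·|S|·A·δ when ‖meanField P B b‖ ≤ δ on S, e.g. δ = lip·dev from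
   `T4FirstOrderSize.CondMeanSuppression`: the (α)/(β) first-order remainder of `T4FirstOrderSize` §3).
§3 Over a `T4TermFormat.Booking`.  `Relin Bk β E T`: per birth and scale the bond support, the admissible exterior
   configurations, the polydisc radius, the weight, the carried value, the re-linearised coefficient field, and the
   two arrays `amp b k`, `draw b k`; shapes `AmpSpec`, `RemSpec`; `resp b k` (= `respNorm …`); the SIZE CONVENTION
   `SizeIsResp` (the booking's `size b k` IS the response norm, so that "size" dominates exactly the norm the next
   re-linearisation responds to: `abs_flucPart_val_le_size`); the TRANSPORT shapes `Transport ρ` (resp at k + 1 ≤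
   ρ · resp at k; parts `Transport₁` / `Transport₂`) — THE DECISIVE OPEN INPUT of the line (the response-flatness
   gain per step; cell value ρ = φ = L⁻²; NOT PRINTED, NOT asserted) — and the birth profile `BirthResp σ₀`.
   KERNEL: `resp_le_geom`; `sizeBound_of_transport` (⇒ `Booking.SizeBound (σ₀ j · ρ^{k−j})` via
   `Booking.sizeBound_of_step` — the later-scale size link the row asks for); `cubeBudget_of_transport` (σ₀ j ≤
   A·τ^{K−j}, i.e. exactly ONE factor τ = θ₁ per level from birth to the unit scale — the (α)/(β) first-order sup
   rate of `T4FirstOrderSize.supSize_product_eq` — and Λρτ ≤ 1 ⇒ `Booking.CubeBudget` via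
   `Booking.cubeBudget_of_twoRate`); `etaBudget_of_count₂` (the quadratic-currency slot with a TWO-index draw
   profile, via `Booking.sum_feltAt_le`); `sum_count_rate_le` (counts N₀Λ^{k−j} against draws e₀φ^{k−j}τ^{K−j} with
   Λφτ ≤ r < 1 ⇒ the K-UNIFORM slot constant N₀e₀/(1 − r)).  v1.1 (rung t4/T4-RUNG-O3Ei-gamma2a.md): the
   k-STEP TWIN `TransportFrom ρ C` (resp b k ≤ C·ρ^{k−j}·resp b j, j the birth scale) — the shape a k-uniform
   regularity bound of the printed type supplies (B5 = [Balaban1984PropagatorsI] Prop. 1.2 (1.115): sup/Hölder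
   bounds for the minimizers' Green's functions with constants depending on d only; NOT asserted here); per-step
   `Transport ρ` ⇒ `TransportFrom ρ 1` (`transportFrom_of_transport`, = `resp_le_geom`), NOT conversely (the
   linearised Gaussian toy of the rung has steps of GROWTH with k-step decay); KERNEL `sizeBound_of_transportFrom`
   (⇒ `Booking.SizeBound (C·σ₀ j·ρ^{k−j})` directly, no recursion) and `cubeBudget_of_transportFrom` (the same cube
   budget with constant (N₀·(C·A))·W); the one-step recursion `size_succ_le_of_transport` has NO k-step analogue for
   true sizes — an array-level step shape fed by `TransportFrom` must book envelope sizes C·σ₀ j·ρ^{k−j}, not the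
   response norms themselves.
§4 WHY IT MIGHT FAIL, as a theorem.  `no_uniform_slot_of_frozen_draw`: if the per-term draw at the top scale stays
   ≥ c₀ > 0 — a remainder second order in the fluctuation but first order in μ with a constant that does NOT decay
   in k − j — while at least Λ^{K−j} terms of birth scale j are felt (Λ > 1), then for every budget some depth K
   violates the slot (an instance of `T4TubeBudget.not_tubeBudget_of_osc`).  So the line needs the draw / response
   profiles to decay geometrically in k − j at a rate beating the count; that decay is the open estimate O-γ2 (=
   O-G1 of t4/T4-EST-O3Eiiib.md §5), not supplied here.
§5 Non-vacuity.  `exampleVal b₀ a₀ t B = t⟪a₀, B b₀⟫ + ‖B b₀‖²`: its remainder is ‖B b₀‖² exactly, `RemBound` holds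
   with q = 2 and `AmpBound` with A = ‖a₀‖ (the function-level shapes are jointly inhabited by a non-linear
   function); `Relin.zero` inhabits the booking-level shapes over any booking.

NOT TYPED / NOT CLAIMED.  No value of ρ, of the draw profile, or of the birth arrays is derived: `Transport`,
`TransportFrom`, `BirthResp`, `AmpSpec`, `RemSpec`, `SecondMoments` are hypotheses.  No statement about Bałaban's own terms is made
(Lemma 1 / Lemma 2 above are context).  The array-level step `TStep.Relinearises ρ Gate σ` of `T4PreservedUnderT`
(row T4-O3.E-i′-iii-b) is neither imported nor re-typed: a supplier of `Relin.Transport ρ` + `Relin.SizeIsResp`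
discharges the size recursion through `Booking.sizeBound_of_step` here, in `T4TermFormat`'s own shape
`Booking.SizeBound`.  The ℂ-valued function-level slots `CarrierAt.OneStepBound` / `CarrierAt.SizeDominatesAt` of
`T4TermFormat` §4b are the abstract twins of `Transport` / `SizeIsResp`; this file is the real, bond-field special
case in which the linear part can be separated and charged.  Conditional expectations are not constructed: §2 takes
the law `P` of the fluctuation field at one exterior configuration as given, as `T4FirstOrderSize` §3 does.  The
analytic origin of a remainder bound (Cauchy estimates of second derivatives on a polydisc, whose constant depends
on the radius and hence on k) is not formalised; it is the reason the row's why-it-might-fail clause speaks of a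
k-dependent constant, and §4 records what such a constant without decay does to the budget.

References: B13 = [Balaban1988RG2Cluster] §1 pp. 2–11 (Lemma 1, Lemma 2), §2 p. 16 (2.18)–(2.20); B5 =
[Balaban1984PropagatorsI] pp. 28–29 (1.59)–(1.67) (the minimizer H_k), pp. 35–36 Proposition 1.2 (1.110)–(1.117)
(CONTEXT ONLY for `TransportFrom`, v1.1); cell records
T4-REF-O3 V4/V5, T4-DAG v4 §5 (row T4-O3.E-i′-Oγ2°) and §8 Q14, GAPS G-pv16g4-7 / G-pv16g4-8,
t4/T4-EST-O3Eiiib.md §5 (O-G1, O-G6), t4/T4-EST-O3Ei-gamma2.md (this row's record).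
-/

namespace Literature.MathematicalPhysics.QuantumFieldTheory.Balaban1983to89.T4Relinearisation

noncomputable section

open Finset _root_.MeasureTheory
open scoped BigOperators InnerProductSpace
open Literature.MathematicalPhysics.QuantumFieldTheory.Balaban1983to89.T4FirstOrderSize
  (linTerm InCurrency meanField MeanVanishes)
open Literature.MathematicalPhysics.QuantumFieldTheory.Balaban1983to89.T4TermFormat (Booking)

/-! ## §1  One re-expansion around the current background -/

section Shapes

variable {β : Type*} {E : Type*} [NormedAddCommGroup E]

/-- The FLUCTUATION-DEPENDENT PART of a carried piece `f` of the scale-`k` bond field: `f B − f 0` (the value at the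
background is `f 0`; what the scale-`k` integration sees is the rest).  Printed twin: the left side of (1.33), B13 p. 9
(context only). [folklore] -/
def flucPart (f : (β → E) → ℝ) : (β → E) → ℝ := fun B => f B - f 0

/-- `flucPart f B = f B − f 0`. [folklore] -/
@[simp] theorem flucPart_apply (f : (β → E) → ℝ) (B : β → E) : flucPart f B = f B - f 0 := rfl

/-- The fluctuation-dependent part vanishes at the background. [folklore] -/
theorem flucPart_zero (f : (β → E) → ℝ) : flucPart f 0 = 0 := sub_self _

/-- HYPOTHESIS SHAPE — AMPLITUDE of the re-linearised coefficient field on the bond set `S`: `‖a b‖ ≤ A`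
(`T4FirstOrderSize.linearAbsorbed_of_amplitude`'s hypothesis; cell value AT THE BIRTH SCALE `A = c_A g_j θ₁^{K−j}`,
T4-REF-O3 V5 (ii); later-scale amplitudes are the transport question of §3; NOT asserted).
[folklore] -/
def AmpBound (S : Finset β) (a : β → E) (A : ℝ) : Prop := ∀ b ∈ S, ‖a b‖ ≤ A

/-- HYPOTHESIS SHAPE — SECOND-ORDER REMAINDER BOUND: `|r B| ≤ (q/2) · Σ_{b∈S} ‖B b‖²`, i.e. the remainder is charged
to the QUADRATIC currency with coefficient `q` (printed twin of the shape: the quadratic form of (1.42), B13 p. 11,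
context only).  For the cell's carried terms `q` is FIRST ORDER in `|μ|` (the row's why-it-might-fail clause); no
value of `q` is asserted. [folklore] -/
def RemBound (S : Finset β) (q : ℝ) (r : (β → E) → ℝ) : Prop := ∀ B : β → E, |r B| ≤ q / 2 * ∑ b ∈ S, ‖B b‖ ^ 2

/-- HYPOTHESIS SHAPE — the SMALL-FIELD POLYDISC on which a re-expanded term is considered: `‖B b‖ ≤ ρ` on `S`
(printed twin of the shape: `{B : |B| < ε₁g_k⁻¹ on Y}` in (1.34), B13 p. 9, context only). [folklore] -/
def SmallField (S : Finset β) (ρ : ℝ) (B : β → E) : Prop := ∀ b ∈ S, ‖B b‖ ≤ ρ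

/-- On the polydisc of radius `ρ` the quadratic currency of `S` is at most `|S| · ρ²`. [folklore] -/
theorem sum_norm_sq_le_of_smallField {S : Finset β} {ρ : ℝ} {B : β → E} (hB : SmallField S ρ B) :
    ∑ b ∈ S, ‖B b‖ ^ 2 ≤ (S.card : ℝ) * ρ ^ 2 := by
  calc ∑ b ∈ S, ‖B b‖ ^ 2 ≤ ∑ b ∈ S, ρ ^ 2 :=
        sum_le_sum fun b hb => pow_le_pow_left₀ (norm_nonneg _) (hB b hb) 2
    _ = (S.card : ℝ) * ρ ^ 2 := by rw [sum_const, nsmul_eq_mul]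

/-- A remainder in quadratic currency `q ≥ 0` is at most `(q/2) · (|S| · ρ²)` on the polydisc of radius `ρ`.
[folklore] -/
theorem abs_le_of_remBound_of_smallField {S : Finset β} {q ρ : ℝ} {r : (β → E) → ℝ} {B : β → E}
    (hr : RemBound S q r) (hq : 0 ≤ q) (hB : SmallField S ρ B) : |r B| ≤ q / 2 * ((S.card : ℝ) * ρ ^ 2) :=
  (hr B).trans (mul_le_mul_of_nonneg_left (sum_norm_sq_le_of_smallField hB) (by positivity))

variable {Ω : Type*} [MeasurableSpace Ω]

/-- HYPOTHESIS SHAPE — SECOND MOMENTS of the fluctuation field under the law `P` (the conditional law at one exterior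
configuration, taken as given): `∫ ‖B ω b‖² dP ≤ v` and integrable, for `b ∈ S` (cell heuristic: `v ≍ g_k²`, the
one-point variance under the small-field Gaussian step; NOT asserted). [folklore] -/
def SecondMoments (P : Measure Ω) (S : Finset β) (B : Ω → β → E) (v : ℝ) : Prop :=
  ∀ b ∈ S, Integrable (fun ω => ‖B ω b‖ ^ 2) P ∧ ∫ ω, ‖B ω b‖ ^ 2 ∂P ≤ v

end Shapes

/-- THE RESPONSE NORM of a re-expanded term with weight `t`, `n` bonds, amplitude `A`, remainder draw `q`, on the
polydisc of radius `ρ`: first-order sup `|t|·(n·A·ρ)` plus second-order sup `(q/2)·(n·ρ²)`.  This is the typed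
TWO-INDEX SIZE of a term at a later scale (T4-DAG v4 §5 row T4-O3.E-i′-Oγ2°; t4/T4-EST-O3Eiiib.md §5 O-G6: the booked
size must dominate the norm to which the next re-linearisation responds). [folklore] -/
def respNorm (t : ℝ) (n : ℕ) (A q ρ : ℝ) : ℝ := |t| * ((n : ℝ) * A * ρ) + q / 2 * ((n : ℝ) * ρ ^ 2)

/-- The response norm is non-negative for non-negative data. [folklore] -/
theorem respNorm_nonneg (t : ℝ) (n : ℕ) {A q ρ : ℝ} (hA : 0 ≤ A) (hq : 0 ≤ q) (hρ : 0 ≤ ρ) :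
    0 ≤ respNorm t n A q ρ := by
  unfold respNorm; positivity

section Reexpansion

variable {β : Type*} {E : Type*} [NormedAddCommGroup E] [InnerProductSpace ℝ E]

/-- THE SECOND-ORDER REMAINDER of the re-expansion of `f` around the background with linear coefficient field `a`
and weight `t` on the bond set `S`: `f B − f 0 − linTerm t S a B` (printed twin of the move: the second-order Taylor
expansion of B13 p. 10 and the split (1.42) p. 11, context only). [folklore] -/
def relinRem (f : (β → E) → ℝ) (t : ℝ) (S : Finset β) (a : β → E) : (β → E) → ℝ :=
  fun B => f B - f 0 - linTerm t S a B

/-- THE RE-EXPANSION IDENTITY: fluctuation part = linear part + second-order remainder (a definition unfolded).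
[folklore] -/
theorem flucPart_eq_add (f : (β → E) → ℝ) (t : ℝ) (S : Finset β) (a : β → E) (B : β → E) :
    flucPart f B = linTerm t S a B + relinRem f t S a B := by
  simp only [flucPart, relinRem]; ring

omit [InnerProductSpace ℝ E] in
/-- A remainder bound is currency membership with zero constant cost. [folklore] -/
theorem remBound_iff_inCurrency {S : Finset β} {q : ℝ} {r : (β → E) → ℝ} :
    RemBound S q r ↔ InCurrency S q 0 r := by
  simp [RemBound, InCurrency]

omit [InnerProductSpace ℝ E] in
/-- CURRENCY IS ADDITIVE: pieces in currency `(q₁, c₁)` and `(q₂, c₂)` on the same bond set sum to a piece in currency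
`(q₁ + q₂, c₁ + c₂)`. [folklore] -/
theorem inCurrency_add {S : Finset β} {q₁ q₂ c₁ c₂ : ℝ} {v₁ v₂ : (β → E) → ℝ} (h₁ : InCurrency S q₁ c₁ v₁)
    (h₂ : InCurrency S q₂ c₂ v₂) : InCurrency S (q₁ + q₂) (c₁ + c₂) (fun B => v₁ B + v₂ B) := by
  intro B
  have e : (q₁ + q₂) / 2 * ∑ b ∈ S, ‖B b‖ ^ 2 + (c₁ + c₂) * (S.card : ℝ)
      = (q₁ / 2 * ∑ b ∈ S, ‖B b‖ ^ 2 + c₁ * (S.card : ℝ)) + (q₂ / 2 * ∑ b ∈ S, ‖B b‖ ^ 2 + c₂ * (S.card : ℝ)) := by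
    ring
  rw [e]
  exact (abs_add_le _ _).trans (add_le_add (h₁ B) (h₂ B))

/-- (γ) THE FLUCTUATION-DEPENDENT PART IS IN CURRENCY AT EVERY RE-EXPANSION: with amplitude `A` of the re-linearised
coefficients, remainder draw `q`, and any Cauchy–Schwarz currency `η > 0` for the linear part,
`|f B − f 0| ≤ ((η + q)/2)·Σ_{b∈S}‖B b‖² + ((tA)²/(2η))·|S|` for EVERY field `B` — the linear part by
`T4FirstOrderSize.linearAbsorbed_of_amplitude` (exact algebra, no expectation taken), the remainder by its own draw.
At which scales the total draw fits under the printed `½O(1)α₄` is the slot question of §3 (`etaBudget_of_count₂`).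
[folklore] -/
theorem inCurrency_flucPart {f : (β → E) → ℝ} {t : ℝ} {S : Finset β} {a : β → E} {A q η : ℝ} (hA : AmpBound S a A)
    (hr : RemBound S q (relinRem f t S a)) (hη : 0 < η) :
    InCurrency S (η + q) ((t * A) ^ 2 / (2 * η)) (flucPart f) := by
  have h₁ : InCurrency S η ((t * A) ^ 2 / (2 * η)) (linTerm t S a) :=
    T4FirstOrderSize.linearAbsorbed_of_amplitude hA t hη
  have h₂ : InCurrency S q 0 (relinRem f t S a) := remBound_iff_inCurrency.mp hr
  have h := inCurrency_add h₁ h₂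
  rw [add_zero] at h
  have e : flucPart f = fun B => linTerm t S a B + relinRem f t S a B := funext (flucPart_eq_add f t S a)
  rw [e]
  exact h

/-- THE SUP BOUND ON THE POLYDISC (function → number): amplitude `A`, remainder draw `q ≥ 0`, field in the polydisc of
radius `ρ` ⇒ `|f B − f 0| ≤ respNorm t |S| A q ρ`.  The first summand is `T4FirstOrderSize.abs_linTerm_le_sup`.
[folklore] -/
theorem abs_flucPart_le {f : (β → E) → ℝ} {t : ℝ} {S : Finset β} {a : β → E} {A q ρ : ℝ} {B : β → E}
    (hA : AmpBound S a A) (hr : RemBound S q (relinRem f t S a)) (hq : 0 ≤ q) (hB : SmallField S ρ B) :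
    |flucPart f B| ≤ respNorm t S.card A q ρ := by
  rw [flucPart_eq_add f t S a B]
  exact (abs_add_le _ _).trans
    (add_le_add (T4FirstOrderSize.abs_linTerm_le_sup hA hB t) (abs_le_of_remBound_of_smallField hr hq hB))

/-! ## §2  What one integration leaves: the carried correction -/

variable {Ω : Type*} [MeasurableSpace Ω]

/-- The linear part is integrable as soon as the bond variables on `S` are. [folklore] -/
theorem integrable_linTerm (P : Measure Ω) (t : ℝ) (S : Finset β) (a : β → E) (B : Ω → β → E)
    (hB : ∀ b ∈ S, Integrable (fun ω => B ω b) P) : Integrable (fun ω => linTerm t S a (B ω)) P := by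
  unfold T4FirstOrderSize.linTerm
  exact (integrable_finsetSum S fun b hb => (hB b hb).const_inner (a b)).const_mul t

/-- THE INTEGRATION IDENTITY (exact): integrating the fluctuation-dependent part against the law `P` of the scale-`k`
fluctuation field leaves the linear part AT THE MEAN FIELD plus the integrated remainder,
`∫ (f (B ω) − f 0) dP = linTerm t S a (meanField P B) + ∫ relinRem f t S a (B ω) dP`
(`T4FirstOrderSize.integral_linTerm`).  Under `MeanVanishes` (centred Gaussian step) the first summand is `0`:
`integral_flucPart_of_meanVanishes`. [folklore] -/
theorem integral_flucPart [CompleteSpace E] (P : Measure Ω) (f : (β → E) → ℝ) (t : ℝ) (S : Finset β) (a : β → E)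
    (B : Ω → β → E) (hB : ∀ b ∈ S, Integrable (fun ω => B ω b) P)
    (hrem : Integrable (fun ω => relinRem f t S a (B ω)) P) :
    ∫ ω, flucPart f (B ω) ∂P = linTerm t S a (meanField P B) + ∫ ω, relinRem f t S a (B ω) ∂P := by
  have hlin := integrable_linTerm P t S a B hB
  simp_rw [flucPart_eq_add f t S a]
  rw [integral_add hlin hrem, T4FirstOrderSize.integral_linTerm P t S a B hB]

/-- Under `MeanVanishes S (meanField P B)` only the integrated remainder is carried. [folklore] -/
theorem integral_flucPart_of_meanVanishes [CompleteSpace E] (P : Measure Ω) (f : (β → E) → ℝ) (t : ℝ)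
    (S : Finset β) (a : β → E) (B : Ω → β → E) (hB : ∀ b ∈ S, Integrable (fun ω => B ω b) P)
    (hrem : Integrable (fun ω => relinRem f t S a (B ω)) P) (h0 : MeanVanishes S (meanField P B)) :
    ∫ ω, flucPart f (B ω) ∂P = ∫ ω, relinRem f t S a (B ω) ∂P := by
  rw [integral_flucPart P f t S a B hB hrem, T4FirstOrderSize.linTerm_eq_zero_of_meanVanishes h0 t a, zero_add]

omit [InnerProductSpace ℝ E] in
/-- THE DIAGONAL SECOND-ORDER CORRECTION (γ1): a remainder in quadratic currency `q ≥ 0` integrates, under second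
moments `≤ v`, to at most `(q/2)·(|S|·v)` — first order in `μ` through `q`. [folklore] -/
theorem abs_integral_le_of_remBound (P : Measure Ω) {S : Finset β} {q v : ℝ} {r : (β → E) → ℝ} {B : Ω → β → E}
    (hr : RemBound S q r) (hq : 0 ≤ q) (hm : SecondMoments P S B v) :
    |∫ ω, r (B ω) ∂P| ≤ q / 2 * ((S.card : ℝ) * v) := by
  have hg : Integrable (fun ω => q / 2 * ∑ b ∈ S, ‖B ω b‖ ^ 2) P :=
    (integrable_finsetSum S fun b hb => (hm b hb).1).const_mul (q / 2)
  have h1 : ‖∫ ω, r (B ω) ∂P‖ ≤ ∫ ω, q / 2 * ∑ b ∈ S, ‖B ω b‖ ^ 2 ∂P :=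
    norm_integral_le_of_norm_le hg (Filter.Eventually.of_forall fun ω => by
      rw [Real.norm_eq_abs]; exact hr (B ω))
  rw [Real.norm_eq_abs] at h1
  refine h1.trans ?_
  rw [integral_const_mul, integral_finsetSum S fun b hb => (hm b hb).1]
  refine mul_le_mul_of_nonneg_left ?_ (by positivity)
  calc ∑ b ∈ S, ∫ ω, ‖B ω b‖ ^ 2 ∂P ≤ ∑ b ∈ S, v := sum_le_sum fun b hb => (hm b hb).2
    _ = (S.card : ℝ) * v := by rw [sum_const, nsmul_eq_mul]

/-- THE CARRIED CORRECTION after one integration: if the mean field is bounded by `δ` on `S` (e.g. `δ = lip · dev u`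
from `T4FirstOrderSize.CondMeanSuppression` at an exterior configuration `u`: the (α)/(β) first-order remainder) and
the second moments by `v` (the (γ1) diagonal second order), then
`|∫ (f (B ω) − f 0) dP| ≤ |t|·(|S|·A·δ) + (q/2)·(|S|·v)`; both summands are first order in `μ` (through `t`, `q`).
[folklore] -/
theorem abs_integral_flucPart_le [CompleteSpace E] (P : Measure Ω) {f : (β → E) → ℝ} {t : ℝ} {S : Finset β}
    {a : β → E} {A q v δ : ℝ} {B : Ω → β → E} (hA : AmpBound S a A) (hr : RemBound S q (relinRem f t S a))
    (hq : 0 ≤ q) (hB : ∀ b ∈ S, Integrable (fun ω => B ω b) P)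
    (hrem : Integrable (fun ω => relinRem f t S a (B ω)) P) (hm : SecondMoments P S B v)
    (hmean : ∀ b ∈ S, ‖meanField P B b‖ ≤ δ) :
    |∫ ω, flucPart f (B ω) ∂P| ≤ |t| * ((S.card : ℝ) * A * δ) + q / 2 * ((S.card : ℝ) * v) := by
  rw [integral_flucPart P f t S a B hB hrem]
  exact (abs_add_le _ _).trans
    (add_le_add (T4FirstOrderSize.abs_linTerm_le_sup hA hmean t) (abs_integral_le_of_remBound P hr hq hm))

/-- The flat case: under `MeanVanishes` only the (γ1) correction `(q/2)·(|S|·v)` is carried. [folklore] -/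
theorem abs_integral_flucPart_le_of_meanVanishes [CompleteSpace E] (P : Measure Ω) {f : (β → E) → ℝ} {t : ℝ}
    {S : Finset β} {a : β → E} {q v : ℝ} {B : Ω → β → E} (hr : RemBound S q (relinRem f t S a)) (hq : 0 ≤ q)
    (hB : ∀ b ∈ S, Integrable (fun ω => B ω b) P) (hrem : Integrable (fun ω => relinRem f t S a (B ω)) P)
    (hm : SecondMoments P S B v) (h0 : MeanVanishes S (meanField P B)) :
    |∫ ω, flucPart f (B ω) ∂P| ≤ q / 2 * ((S.card : ℝ) * v) := by
  rw [integral_flucPart_of_meanVanishes P f t S a B hB hrem h0]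
  exact abs_integral_le_of_remBound P hr hq hm

end Reexpansion

/-! ## §3  Scale by scale over a `Booking`: the re-expansion data, the response norm as the size, the transport -/

/-- THE RE-EXPANSION DATA of a booking's births along their branches (T4-DAG v4 §5 row T4-O3.E-i′-Oγ2°): for the term
born at `b` and every scale `k`, the bond support `supp b k` of the scale-`k` fluctuation field it responds to, the
admissible exterior configurations `dom b k`, the carried real value `val b k τ` as a function of the bond field, the
re-linearised coefficient field `coef b k τ`, and two ARRAYS: the amplitude bound `amp b k` and the remainder draw
`draw b k`; `rad k` is the small-field radius at scale `k` and `wt b` the real weight pulled out of the complex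
parameter.  Pure data; the estimates relating them are the hypothesis shapes `AmpSpec`, `RemSpec`, `Transport`,
`BirthResp` below.  The ℂ-valued abstract twin is `T4TermFormat.Booking.CarrierAt`. [folklore] -/
structure Relin (Bk : Booking) (β E T : Type*) where
  /-- bond support of the scale-`k` fluctuation field seen by the term born at `b` -/
  supp : Bk.Birth → ℕ → Finset β
  /-- admissible exterior (block-field tower) configurations at scale `k` -/
  dom : Bk.Birth → ℕ → Set T
  /-- small-field polydisc radius at scale `k` -/
  rad : ℕ → ℝ
  /-- radii are non-negative -/
  rad_nonneg : ∀ k, 0 ≤ rad k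
  /-- real weight of the term born at `b` (modulus of the pulled-out complex parameter) -/
  wt : Bk.Birth → ℝ
  /-- the carried value at scale `k`, exterior configuration `τ`, as a function of the bond field -/
  val : Bk.Birth → ℕ → T → (β → E) → ℝ
  /-- the re-linearised coefficient field at scale `k` -/
  coef : Bk.Birth → ℕ → T → β → E
  /-- amplitude bound array -/
  amp : Bk.Birth → ℕ → ℝ
  /-- amplitudes are non-negative -/
  amp_nonneg : ∀ b k, 0 ≤ amp b k
  /-- remainder draw array (quadratic currency of the second-order remainder) -/
  draw : Bk.Birth → ℕ → ℝ
  /-- draws are non-negative -/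
  draw_nonneg : ∀ b k, 0 ≤ draw b k

namespace Relin

section Data

variable {Bk : Booking} {β : Type*} {E : Type*} [NormedAddCommGroup E] [InnerProductSpace ℝ E] {T : Type*}

/-- The second-order remainder of the term born at `b`, re-expanded at scale `k`, exterior configuration `τ`.
[folklore] -/
def rem (R : Relin Bk β E T) (b : Bk.Birth) (k : ℕ) (τ : T) : (β → E) → ℝ := relinRem (R.val b k τ) (R.wt b) (R.supp b k) (R.coef b k τ)

/-- HYPOTHESIS SHAPE — the amplitude array bounds the re-linearised coefficients along the branch. [folklore] -/
def AmpSpec (R : Relin Bk β E T) : Prop :=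
  ∀ (b : Bk.Birth) (k : ℕ), Bk.birthScale b ≤ k → k ≤ Bk.K → ∀ τ ∈ R.dom b k,
    AmpBound (R.supp b k) (R.coef b k τ) (R.amp b k)

/-- HYPOTHESIS SHAPE — the draw array bounds the second-order remainders along the branch (second order in the
fluctuation; for the cell's terms first order in `μ`; NOT asserted). [folklore] -/
def RemSpec (R : Relin Bk β E T) : Prop :=
  ∀ (b : Bk.Birth) (k : ℕ), Bk.birthScale b ≤ k → k ≤ Bk.K → ∀ τ ∈ R.dom b k,
    RemBound (R.supp b k) (R.draw b k) (R.rem b k τ)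

/-- First-order response of the term born at `b` at scale `k`: `|wt b|·(|supp b k|·amp b k·rad k)`. [folklore] -/
def resp₁ (R : Relin Bk β E T) (b : Bk.Birth) (k : ℕ) : ℝ := |R.wt b| * (((R.supp b k).card : ℝ) * R.amp b k * R.rad k)

/-- Second-order response of the term born at `b` at scale `k`: `(draw b k/2)·(|supp b k|·rad k²)`. [folklore] -/
def resp₂ (R : Relin Bk β E T) (b : Bk.Birth) (k : ℕ) : ℝ := R.draw b k / 2 * (((R.supp b k).card : ℝ) * R.rad k ^ 2)

/-- THE RESPONSE NORM of the term born at `b` at scale `k` (= `respNorm`): the typed two-index size. [folklore] -/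
def resp (R : Relin Bk β E T) (b : Bk.Birth) (k : ℕ) : ℝ := R.resp₁ b k + R.resp₂ b k

omit [NormedAddCommGroup E] [InnerProductSpace ℝ E] in
/-- `resp` is `respNorm` of the term's data. [folklore] -/
theorem resp_eq_respNorm (R : Relin Bk β E T) (b : Bk.Birth) (k : ℕ) :
    R.resp b k = respNorm (R.wt b) (R.supp b k).card (R.amp b k) (R.draw b k) (R.rad k) := rfl

omit [NormedAddCommGroup E] [InnerProductSpace ℝ E] in
/-- First-order responses are non-negative. [folklore] -/
theorem resp₁_nonneg (R : Relin Bk β E T) (b : Bk.Birth) (k : ℕ) : 0 ≤ R.resp₁ b k := by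
  have := R.amp_nonneg b k; have := R.rad_nonneg k; unfold resp₁; positivity

omit [NormedAddCommGroup E] [InnerProductSpace ℝ E] in
/-- Second-order responses are non-negative. [folklore] -/
theorem resp₂_nonneg (R : Relin Bk β E T) (b : Bk.Birth) (k : ℕ) : 0 ≤ R.resp₂ b k := by
  have := R.draw_nonneg b k; have := R.rad_nonneg k; unfold resp₂; positivity

omit [NormedAddCommGroup E] [InnerProductSpace ℝ E] in
/-- Response norms are non-negative. [folklore] -/
theorem resp_nonneg (R : Relin Bk β E T) (b : Bk.Birth) (k : ℕ) : 0 ≤ R.resp b k :=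
  add_nonneg (R.resp₁_nonneg b k) (R.resp₂_nonneg b k)


/-- FUNCTION → NUMBER along the branch: on the scale-`k` polydisc the fluctuation-dependent part of the term born at
`b` is at most its response norm. [folklore] -/
theorem abs_flucPart_val_le {R : Relin Bk β E T} (hA : R.AmpSpec) (hr : R.RemSpec) {b : Bk.Birth} {k : ℕ} (hjk : Bk.birthScale b ≤ k)
    (hk : k ≤ Bk.K) {τ : T} (hτ : τ ∈ R.dom b k) {B : β → E} (hB : SmallField (R.supp b k) (R.rad k) B) :
    |flucPart (R.val b k τ) B| ≤ R.resp b k :=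
  abs_flucPart_le (hA b k hjk hk τ hτ) (hr b k hjk hk τ hτ) (R.draw_nonneg b k) hB

/-- (γ) AT EVERY SCALE: the fluctuation-dependent part of the term born at `b`, re-expanded at ANY later scale `k`, is
in currency on its bond support with draw `η + draw b k` and constant cost `(wt b · amp b k)²/(2η)`. [folklore] -/
theorem inCurrency_val {R : Relin Bk β E T} (hA : R.AmpSpec) (hr : R.RemSpec) {b : Bk.Birth} {k : ℕ} (hjk : Bk.birthScale b ≤ k)
    (hk : k ≤ Bk.K) {τ : T} (hτ : τ ∈ R.dom b k) {η : ℝ} (hη : 0 < η) :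
    InCurrency (R.supp b k) (η + R.draw b k) ((R.wt b * R.amp b k) ^ 2 / (2 * η)) (flucPart (R.val b k τ)) :=
  inCurrency_flucPart (hA b k hjk hk τ hτ) (hr b k hjk hk τ hτ) hη


/-- THE SIZE CONVENTION (t4/T4-EST-O3Eiiib.md §5 O-G6): the booking's size array IS the response norm along every
branch — so that the booked size dominates exactly the norm the next re-linearisation responds to.  A `Prop` about
the pair (booking, re-expansion data); the cell's bookings are to be built so that it holds. [folklore] -/
def SizeIsResp (R : Relin Bk β E T) : Prop := ∀ (b : Bk.Birth) (k : ℕ), Bk.birthScale b ≤ k → k ≤ Bk.K → Bk.size b k = R.resp b k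


/-- THE LATER-SCALE SIZE/CARRIER LINK (the real twin of `T4TermFormat.Booking.CarrierAt.SizeDominatesAt`): under the
size convention the booked size at scale `k` dominates the term's fluctuation-dependent part on the scale-`k`
polydisc. [folklore] -/
theorem abs_flucPart_val_le_size {R : Relin Bk β E T} (hs : R.SizeIsResp) (hA : R.AmpSpec) (hr : R.RemSpec) {b : Bk.Birth} {k : ℕ}
    (hjk : Bk.birthScale b ≤ k) (hk : k ≤ Bk.K) {τ : T} (hτ : τ ∈ R.dom b k) {B : β → E}
    (hB : SmallField (R.supp b k) (R.rad k) B) : |flucPart (R.val b k τ) B| ≤ Bk.size b k := by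
  rw [hs b k hjk hk]; exact abs_flucPart_val_le hA hr hjk hk hτ hB


/-- HYPOTHESIS SHAPE — TRANSPORT of the response norm one scale up the branch: `resp b (k+1) ≤ ρ · resp b k`.  THE
DECISIVE OPEN INPUT of the line (the response-flatness gain per re-linearisation step; cell value `ρ = φ = L⁻²`,
T4-REF-O3 V4 (β)/(β2); the function-level supplier of `T4PreservedUnderT`'s array-level `Relinearises ρ …`); NOT
PRINTED, NOT asserted. [folklore] -/
def Transport (R : Relin Bk β E T) (ρ : ℝ) : Prop :=
  ∀ (b : Bk.Birth) (k : ℕ), Bk.birthScale b ≤ k → k < Bk.K → R.resp b (k + 1) ≤ ρ * R.resp b k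

/-- HYPOTHESIS SHAPE — transport of the FIRST-order response: `resp₁ b (k+1) ≤ ρ₁ · resp₁ b k`. [folklore] -/
def Transport₁ (R : Relin Bk β E T) (ρ₁ : ℝ) : Prop :=
  ∀ (b : Bk.Birth) (k : ℕ), Bk.birthScale b ≤ k → k < Bk.K → R.resp₁ b (k + 1) ≤ ρ₁ * R.resp₁ b k

/-- HYPOTHESIS SHAPE — transport of the SECOND-order response: `resp₂ b (k+1) ≤ ρ₂ · resp₂ b k`. [folklore] -/
def Transport₂ (R : Relin Bk β E T) (ρ₂ : ℝ) : Prop :=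
  ∀ (b : Bk.Birth) (k : ℕ), Bk.birthScale b ≤ k → k < Bk.K → R.resp₂ b (k + 1) ≤ ρ₂ * R.resp₂ b k

/-- HYPOTHESIS SHAPE — BIRTH PROFILE: at its birth scale the response norm of a term of scale `j` is at most `σ₀ j`
(row T4-O3.E-i′: the first-order sup size `(4c_A|t|r)M⁴·g_j·θ₁^{K−j}` of `T4FirstOrderSize.supSize_product_eq` plus
the second-order birth draw; NO flatness factor at birth, GAPS G-pv16g4-7 (β1); NOT asserted). [folklore] -/
def BirthResp (R : Relin Bk β E T) (σ₀ : ℕ → ℝ) : Prop := ∀ b : Bk.Birth, R.resp b (Bk.birthScale b) ≤ σ₀ (Bk.birthScale b)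


omit [NormedAddCommGroup E] [InnerProductSpace ℝ E] in
/-- Separate transport of the two parts at rates `ρ₁, ρ₂ ≤ ρ` is transport of the response norm at rate `ρ`.
[folklore] -/
theorem transport_of_parts {R : Relin Bk β E T} {ρ₁ ρ₂ ρ : ℝ} (h₁ : R.Transport₁ ρ₁) (h₂ : R.Transport₂ ρ₂) (hρ₁ : ρ₁ ≤ ρ)
    (hρ₂ : ρ₂ ≤ ρ) : R.Transport ρ := by
  intro b k hjk hk
  unfold resp
  calc R.resp₁ b (k + 1) + R.resp₂ b (k + 1) ≤ ρ₁ * R.resp₁ b k + ρ₂ * R.resp₂ b k :=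
        add_le_add (h₁ b k hjk hk) (h₂ b k hjk hk)
    _ ≤ ρ * R.resp₁ b k + ρ * R.resp₂ b k :=
        add_le_add (mul_le_mul_of_nonneg_right hρ₁ (R.resp₁_nonneg b k))
          (mul_le_mul_of_nonneg_right hρ₂ (R.resp₂_nonneg b k))
    _ = ρ * (R.resp₁ b k + R.resp₂ b k) := by ring

omit [NormedAddCommGroup E] [InnerProductSpace ℝ E] in
/-- Separate birth bounds of the two parts give a birth profile. [folklore] -/
theorem birthResp_of_parts {R : Relin Bk β E T} {σ₁ σ₂ : ℕ → ℝ} (h₁ : ∀ b : Bk.Birth, R.resp₁ b (Bk.birthScale b) ≤ σ₁ (Bk.birthScale b))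
    (h₂ : ∀ b : Bk.Birth, R.resp₂ b (Bk.birthScale b) ≤ σ₂ (Bk.birthScale b)) :
    R.BirthResp (fun j => σ₁ j + σ₂ j) := fun b => add_le_add (h₁ b) (h₂ b)

omit [NormedAddCommGroup E] [InnerProductSpace ℝ E] in
/-- GEOMETRIC TRANSPORT: a one-step rate `ρ ≥ 0` along the branch gives `resp b k ≤ ρ^{k−j} · resp b j` at every
later scale `k ≤ K` (`j` the birth scale). [folklore] -/
theorem resp_le_geom {R : Relin Bk β E T} {ρ : ℝ} (hρ : 0 ≤ ρ) (h : R.Transport ρ) (b : Bk.Birth) {k : ℕ} (hjk : Bk.birthScale b ≤ k)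
    (hk : k ≤ Bk.K) : R.resp b k ≤ ρ ^ (k - Bk.birthScale b) * R.resp b (Bk.birthScale b) := by
  induction k, hjk using Nat.le_induction with
  | base => simp
  | succ k hjk ih =>
    have hk' : k < Bk.K := Nat.lt_of_succ_le hk
    have e : k + 1 - Bk.birthScale b = (k - Bk.birthScale b) + 1 := by omega
    calc R.resp b (k + 1) ≤ ρ * R.resp b k := h b k hjk hk'
      _ ≤ ρ * (ρ ^ (k - Bk.birthScale b) * R.resp b (Bk.birthScale b)) :=
          mul_le_mul_of_nonneg_left (ih hk'.le) hρ
      _ = ρ ^ (k + 1 - Bk.birthScale b) * R.resp b (Bk.birthScale b) := by rw [e, pow_succ]; ring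

omit [NormedAddCommGroup E] [InnerProductSpace ℝ E] in
/-- THE LATER-SCALE SIZE BOUND the row asks for: under the size convention, a birth profile `σ₀` and a transport rate
`ρ ≥ 0`, the booking satisfies `SizeBound (σ₀ j · ρ^{k−j})` — by `T4TermFormat.Booking.sizeBound_of_step` (birth
bound + one-step recursion). [folklore] -/
theorem sizeBound_of_transport {R : Relin Bk β E T} {ρ : ℝ} {σ₀ : ℕ → ℝ} (hρ : 0 ≤ ρ) (hs : R.SizeIsResp) (h0 : R.BirthResp σ₀)
    (h : R.Transport ρ) : Bk.SizeBound (fun j k => σ₀ j * ρ ^ (k - j)) := by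
  refine Booking.sizeBound_of_step ?_ ?_
  · intro b
    rw [hs b _ le_rfl (Bk.birth_le b), Nat.sub_self, pow_zero, mul_one]
    exact h0 b
  · intro b k hjk hk hsz
    rw [hs b (k + 1) (Nat.le_succ_of_le hjk) hk]
    rw [hs b k hjk hk.le] at hsz
    have e : k + 1 - Bk.birthScale b = (k - Bk.birthScale b) + 1 := by omega
    calc R.resp b (k + 1) ≤ ρ * R.resp b k := h b k hjk hk
      _ ≤ ρ * (σ₀ (Bk.birthScale b) * ρ ^ (k - Bk.birthScale b)) := mul_le_mul_of_nonneg_left hsz hρ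
      _ = σ₀ (Bk.birthScale b) * ρ ^ (k + 1 - Bk.birthScale b) := by rw [e, pow_succ]; ring

omit [NormedAddCommGroup E] [InnerProductSpace ℝ E] in
/-- THE (α)/(β) BUDGET SEAM: if moreover the birth profile carries exactly ONE factor `τ` per level from birth to the
unit scale, `σ₀ j ≤ A · τ^{K−j}` (`τ = θ₁`, the first-order sup rate of `T4FirstOrderSize.supSize_product_eq`), the
positional counts are `≤ N₀ · Λ^{k−j}` and `Λ · ρ · τ ≤ 1`, `τ ≤ 1`, then the booking's cube budget holds with
constant `(N₀A)·W` — `T4TermFormat.Booking.cubeBudget_of_twoRate` with `(Λ, φ, τ) := (Λ, ρ, τ)` (cell instance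
`(L⁴, φ, θ₁)`, T4-DAG v4 §8 Q14 (2)). [folklore] -/
theorem cubeBudget_of_transport {R : Relin Bk β E T} {ρ τ A N₀ Λ W : ℝ} {N : ℕ → ℕ → ℝ} {w : ℕ → ℝ} {σ₀ : ℕ → ℝ}
    (hs : R.SizeIsResp) (h0 : R.BirthResp σ₀) (h : R.Transport ρ) (hσ₀0 : ∀ j, 0 ≤ σ₀ j)
    (hσ₀ : ∀ j, j ≤ Bk.K → σ₀ j ≤ A * τ ^ (Bk.K - j)) (hw : ∀ j ≤ Bk.K, 0 ≤ w j)
    (hW : ∑ j ∈ range (Bk.K + 1), w j ≤ W) (hN : Bk.PositionalCount N) (hN₀ : 0 ≤ N₀) (hA : 0 ≤ A) (hΛ : 0 ≤ Λ)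
    (hρ : 0 ≤ ρ) (hτ0 : 0 ≤ τ) (hτ1 : τ ≤ 1) (hΛρτ : Λ * ρ * τ ≤ 1)
    (hNle : ∀ j k, j ≤ k → k ≤ Bk.K → N j k ≤ N₀ * Λ ^ (k - j)) : Bk.CubeBudget w ((N₀ * A) * W) :=
  Booking.cubeBudget_of_twoRate hw hW hN (sizeBound_of_transport hρ hs h0 h)
    (fun j k => mul_nonneg (hσ₀0 j) (pow_nonneg hρ _)) hN₀ hA hΛ hρ hτ0 hτ1 hΛρτ hNle
    (fun j k hjk hk => by
      calc σ₀ j * ρ ^ (k - j) ≤ A * τ ^ (Bk.K - j) * ρ ^ (k - j) :=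
            mul_le_mul_of_nonneg_right (hσ₀ j (hjk.trans hk)) (pow_nonneg hρ _)
        _ = A * ρ ^ (k - j) * τ ^ (Bk.K - j) := by ring)

omit [NormedAddCommGroup E] [InnerProductSpace ℝ E] in
/-- THE ONE-STEP SIZE RECURSION in the shape an array-level step consumes (cf. `T4PreservedUnderT`'s
`TStep.Relinearises ρ Gate σ`, whose `relin b (k+1)` is here the booked size at `k + 1` and whose gate is ignored):
under the size convention and transport at rate `ρ ≥ 0`, `size b k ≤ s ⇒ size b (k+1) ≤ ρ · s`. [folklore] -/
theorem size_succ_le_of_transport {R : Relin Bk β E T} {ρ : ℝ} (hρ : 0 ≤ ρ) (hs : R.SizeIsResp) (h : R.Transport ρ) {b : Bk.Birth}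
    {k : ℕ} (hjk : Bk.birthScale b ≤ k) (hk : k < Bk.K) {s : ℝ} (hsz : Bk.size b k ≤ s) :
    Bk.size b (k + 1) ≤ ρ * s := by
  rw [hs b (k + 1) (Nat.le_succ_of_le hjk) hk]
  rw [hs b k hjk hk.le] at hsz
  exact (h b k hjk hk).trans (mul_le_mul_of_nonneg_left hsz hρ)

omit [NormedAddCommGroup E] [InnerProductSpace ℝ E] in
/-- THE FIRST-ORDER BIRTH RESPONSE from its four factors: weight `≤ t₀`, at most `n₀` bonds, amplitude `≤ A₀`, radius
`≤ r₀` ⇒ `resp₁ b k ≤ t₀·(n₀·A₀·r₀)`.  With the row-O3.E-i′ amplitude `A₀ = c_A·g_j·θ₁^{K−j}` at the birth scale this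
is `(t₀n₀c_Ar₀)·g_j·θ₁^{K−j}` — exactly ONE factor `θ₁` per level from birth to the unit scale
(`T4FirstOrderSize.supSize_product_eq`), the `τ`-profile `cubeBudget_of_transport` consumes. [folklore] -/
theorem resp₁_le_of_bounds {R : Relin Bk β E T} {b : Bk.Birth} {k : ℕ} {t₀ n₀ A₀ r₀ : ℝ} (ht : |R.wt b| ≤ t₀)
    (hn : ((R.supp b k).card : ℝ) ≤ n₀) (ha : R.amp b k ≤ A₀) (hr : R.rad k ≤ r₀) :
    R.resp₁ b k ≤ t₀ * (n₀ * A₀ * r₀) := by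
  have hn0 : (0 : ℝ) ≤ (R.supp b k).card := Nat.cast_nonneg _
  have ha0 := R.amp_nonneg b k
  have hr0 := R.rad_nonneg k
  have h1 : ((R.supp b k).card : ℝ) * R.amp b k ≤ n₀ * A₀ := mul_le_mul hn ha ha0 (hn0.trans hn)
  have h2 : ((R.supp b k).card : ℝ) * R.amp b k * R.rad k ≤ n₀ * A₀ * r₀ :=
    mul_le_mul h1 hr hr0 (mul_nonneg (hn0.trans hn) (ha0.trans ha))
  unfold resp₁
  exact mul_le_mul ht h2 (mul_nonneg (mul_nonneg hn0 ha0) hr0) ((abs_nonneg _).trans ht)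

/-- THE TOTAL QUADRATIC DRAW of the term born at `b` at scale `k`: the chosen Cauchy–Schwarz currency `ηc b k` for the
linear part plus the remainder's own draw (the draw of `inCurrency_val`). [folklore] -/
def drawTotal (R : Relin Bk β E T) (ηc : Bk.Birth → ℕ → ℝ) (b : Bk.Birth) (k : ℕ) : ℝ := ηc b k + R.draw b k

omit [NormedAddCommGroup E] [InnerProductSpace ℝ E] in
/-- HYPOTHESIS SHAPE (v1.1) — k-STEP TRANSPORT WITH ONE CONSTANT: `resp b k ≤ C · ρ^{k−j} · resp b j` for every
later scale `k ≤ K`, `j` the birth scale.  The shape a k-UNIFORM regularity bound of the printed type supplies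
(B5 Prop. 1.2 (1.115): `|∇G_kJ|, ‖∇G_kJ‖_α ≤ O(1)|J|`, constants depending on d only, read back to unit-lattice
variables: rung t4/T4-RUNG-O3Ei-gamma2a.md Rd6/V-b); weaker than `Transport ρ` (which is the case `C = 1` step by
step).  NOT PRINTED as a statement about Bałaban's terms, NOT asserted. [folklore] -/
def TransportFrom (R : Relin Bk β E T) (ρ C : ℝ) : Prop :=
  ∀ (b : Bk.Birth) (k : ℕ), Bk.birthScale b ≤ k → k ≤ Bk.K →
    R.resp b k ≤ C * ρ ^ (k - Bk.birthScale b) * R.resp b (Bk.birthScale b)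

omit [NormedAddCommGroup E] [InnerProductSpace ℝ E] in
/-- Per-step transport at rate `ρ ≥ 0` is k-step transport with constant `1` (`resp_le_geom`); the converse fails
(rung T4-RUNG-O3Ei-gamma2a: per-step growth with k-step decay in the linearised model). [folklore] -/
theorem transportFrom_of_transport {R : Relin Bk β E T} {ρ : ℝ} (hρ : 0 ≤ ρ) (h : R.Transport ρ) :
    R.TransportFrom ρ 1 := fun b k hjk hk => by
  rw [one_mul]; exact resp_le_geom hρ h b hjk hk

omit [NormedAddCommGroup E] [InnerProductSpace ℝ E] in
/-- THE LATER-SCALE SIZE BOUND from the k-step shape, DIRECTLY (no recursion): under the size convention, a birth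
profile `σ₀` and `TransportFrom ρ C` with `ρ, C ≥ 0`, the booking satisfies `SizeBound (C · σ₀ j · ρ^{k−j})` — the
envelope of `sizeBound_of_transport` times the transient constant `C`. [folklore] -/
theorem sizeBound_of_transportFrom {R : Relin Bk β E T} {ρ C : ℝ} {σ₀ : ℕ → ℝ} (hρ : 0 ≤ ρ) (hC : 0 ≤ C)
    (hs : R.SizeIsResp) (h0 : R.BirthResp σ₀) (h : R.TransportFrom ρ C) :
    Bk.SizeBound (fun j k => C * σ₀ j * ρ ^ (k - j)) := by
  intro b k hjk hk
  rw [hs b k hjk hk]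
  calc R.resp b k ≤ C * ρ ^ (k - Bk.birthScale b) * R.resp b (Bk.birthScale b) := h b k hjk hk
    _ ≤ C * ρ ^ (k - Bk.birthScale b) * σ₀ (Bk.birthScale b) :=
        mul_le_mul_of_nonneg_left (h0 b) (mul_nonneg hC (pow_nonneg hρ _))
    _ = C * σ₀ (Bk.birthScale b) * ρ ^ (k - Bk.birthScale b) := by ring

omit [NormedAddCommGroup E] [InnerProductSpace ℝ E] in
/-- THE (α)/(β) BUDGET SEAM from the k-step shape: as `cubeBudget_of_transport`, with the birth constant `A`
replaced by `C · A` — the transient constant of the regularity bound multiplies the admissible birth constant and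
nothing else (`Λ · ρ · τ ≤ 1` is untouched). [folklore] -/
theorem cubeBudget_of_transportFrom {R : Relin Bk β E T} {ρ C τ A N₀ Λ W : ℝ} {N : ℕ → ℕ → ℝ} {w : ℕ → ℝ}
    {σ₀ : ℕ → ℝ} (hs : R.SizeIsResp) (h0 : R.BirthResp σ₀) (h : R.TransportFrom ρ C) (hC : 0 ≤ C)
    (hσ₀0 : ∀ j, 0 ≤ σ₀ j) (hσ₀ : ∀ j, j ≤ Bk.K → σ₀ j ≤ A * τ ^ (Bk.K - j)) (hw : ∀ j ≤ Bk.K, 0 ≤ w j)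
    (hW : ∑ j ∈ range (Bk.K + 1), w j ≤ W) (hN : Bk.PositionalCount N) (hN₀ : 0 ≤ N₀) (hA : 0 ≤ A) (hΛ : 0 ≤ Λ)
    (hρ : 0 ≤ ρ) (hτ0 : 0 ≤ τ) (hτ1 : τ ≤ 1) (hΛρτ : Λ * ρ * τ ≤ 1)
    (hNle : ∀ j k, j ≤ k → k ≤ Bk.K → N j k ≤ N₀ * Λ ^ (k - j)) : Bk.CubeBudget w ((N₀ * (C * A)) * W) :=
  Booking.cubeBudget_of_twoRate hw hW hN (sizeBound_of_transportFrom hρ hC hs h0 h)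
    (fun j k => mul_nonneg (mul_nonneg hC (hσ₀0 j)) (pow_nonneg hρ _)) hN₀ (mul_nonneg hC hA) hΛ hρ hτ0 hτ1 hΛρτ
    hNle
    (fun j k hjk hk => by
      calc C * σ₀ j * ρ ^ (k - j) ≤ C * (A * τ ^ (Bk.K - j)) * ρ ^ (k - j) :=
            mul_le_mul_of_nonneg_right (mul_le_mul_of_nonneg_left (hσ₀ j (hjk.trans hk)) hC) (pow_nonneg hρ _)
        _ = C * A * ρ ^ (k - j) * τ ^ (Bk.K - j) := by ring)

end Data

/-- NON-VACUITY over any booking: the ZERO re-expansion data (empty supports, zero values, zero arrays). [folklore] -/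
def zero (Bk : Booking) (β E T : Type*) [Zero E] : Relin Bk β E T where
  supp := fun _ _ => ∅
  dom := fun _ _ => Set.univ
  rad := fun _ => 0
  rad_nonneg := fun _ => le_rfl
  wt := fun _ => 0
  val := fun _ _ _ _ => 0
  coef := fun _ _ _ _ => 0
  amp := fun _ _ => 0
  amp_nonneg := fun _ _ => le_rfl
  draw := fun _ _ => 0
  draw_nonneg := fun _ _ => le_rfl

section Zero

variable (Bk : Booking) (β : Type*) (E : Type*) [NormedAddCommGroup E] [InnerProductSpace ℝ E] (T : Type*)

/-- The zero data meet the amplitude and remainder shapes, transport at any rate, and any non-negative birth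
profile (the booking-level shapes are jointly inhabited; the size convention holds over any booking with zero sizes,
e.g. `T4TermFormat.Booking.vacuum`). [folklore] -/
theorem zero_spec (ρ : ℝ) {σ₀ : ℕ → ℝ} (hσ₀ : ∀ j, 0 ≤ σ₀ j) :
    (zero Bk β E T).AmpSpec ∧ (zero Bk β E T).RemSpec ∧ (zero Bk β E T).Transport ρ ∧
      (zero Bk β E T).BirthResp σ₀ := by
  refine ⟨?_, ?_, ?_, ?_⟩
  · intro b k _ _ τ _ b' hb'; simp [zero] at hb'
  · intro b k _ _ τ _ B
    simp [zero, rem, relinRem, T4FirstOrderSize.linTerm]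
  · intro b k _ _; simp [zero, resp, resp₁, resp₂]
  · intro b; simpa [zero, resp, resp₁, resp₂] using hσ₀ (Bk.birthScale b)

end Zero

/-- Over `Booking.vacuum K` (no births) the size convention holds for any data, vacuously. [folklore] -/
theorem sizeIsResp_vacuum {β E T : Type*} (K : ℕ) (R : Relin (Booking.vacuum K) β E T) : R.SizeIsResp :=
  fun b => nomatch b

end Relin

/-! ## §3b  The quadratic-currency slot with a two-index draw profile -/

section Slot

variable {Bk : Booking}

/-- THE CURRENCY SLOT with a TWO-INDEX profile (the `k`-dependent twin of `T4TermFormat.Booking.etaBudget_of_count`):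
positional counts `N j k`, per-term draws `d b k ≤ e j k` along the branch, and `Σ_{j≤k} N j k · e j k ≤ E` at every
scale `k ≤ K` give the booking's `EtaBudget d E` (via `Booking.sum_feltAt_le`). [folklore] -/
theorem etaBudget_of_count₂ {N e : ℕ → ℕ → ℝ} {d : Bk.Birth → ℕ → ℝ} {Eη : ℝ} (hN : Bk.PositionalCount N)
    (hd : ∀ (b : Bk.Birth) (k : ℕ), Bk.birthScale b ≤ k → k ≤ Bk.K → d b k ≤ e (Bk.birthScale b) k)
    (he : ∀ j k, 0 ≤ e j k) (hE : ∀ k, k ≤ Bk.K → ∑ j ∈ range (k + 1), N j k * e j k ≤ Eη) :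
    Bk.EtaBudget d Eη := by
  intro q
  refine (Booking.sum_feltAt_le hN q (fun b => d b (Bk.cubeScale q)) (fun j => e j (Bk.cubeScale q))
    (fun b hb => hd b _ (Bk.felt_birth_le q b hb) (Bk.cube_le q)) (fun j => he j _)).trans ?_
  exact hE _ (Bk.cube_le q)

/-- THE STRICT-RATE GATE of the slot: counts `≤ N₀ · Λ^{k−j}` against draws `≤ e₀ · φ^{k−j} · τ^{K−j}` with
`Λ · φ · τ ≤ r < 1` and `τ ≤ 1` give `Σ_{j≤k} N j k · e j k ≤ N₀e₀/(1 − r)`, UNIFORMLY in `k ≤ K` and in `K`.  With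
`r = 1` only a depth-dependent bound survives (cf. `T4TubeBudget.not_tubeBudget_of_osc` and §4). [folklore] -/
theorem sum_count_rate_le {N e : ℕ → ℕ → ℝ} {N₀ e₀ Λ φ τ r : ℝ} {K k : ℕ} (hk : k ≤ K) (hN₀ : 0 ≤ N₀)
    (he₀ : 0 ≤ e₀) (hΛ : 0 ≤ Λ) (hφ : 0 ≤ φ) (hτ0 : 0 ≤ τ) (hτ1 : τ ≤ 1) (hr : Λ * φ * τ ≤ r) (hr1 : r < 1)
    (he0 : ∀ j, j ≤ k → 0 ≤ e j k) (hN : ∀ j, j ≤ k → N j k ≤ N₀ * Λ ^ (k - j))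
    (he : ∀ j, j ≤ k → e j k ≤ e₀ * φ ^ (k - j) * τ ^ (K - j)) :
    ∑ j ∈ range (k + 1), N j k * e j k ≤ N₀ * e₀ / (1 - r) := by
  have hπ0 : 0 ≤ Λ * φ * τ := by positivity
  have hr0 : 0 ≤ r := hπ0.trans hr
  have hterm : ∀ j ∈ range (k + 1), N j k * e j k ≤ (N₀ * e₀) * r ^ (k - j) := by
    intro j hj
    have hjk : j ≤ k := Nat.lt_succ_iff.mp (mem_range.mp hj)
    have hN0 : 0 ≤ N₀ * Λ ^ (k - j) := by positivity
    have h1 : N j k * e j k ≤ (N₀ * Λ ^ (k - j)) * (e₀ * φ ^ (k - j) * τ ^ (K - j)) :=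
      mul_le_mul (hN j hjk) (he j hjk) (he0 j hjk) hN0
    have hsplit : K - j = (k - j) + (K - k) := by omega
    have h2 : (N₀ * Λ ^ (k - j)) * (e₀ * φ ^ (k - j) * τ ^ (K - j))
        = (N₀ * e₀) * ((Λ * φ * τ) ^ (k - j) * τ ^ (K - k)) := by
      rw [hsplit, pow_add]; ring
    have h3 : (Λ * φ * τ) ^ (k - j) * τ ^ (K - k) ≤ r ^ (k - j) := by
      calc (Λ * φ * τ) ^ (k - j) * τ ^ (K - k) ≤ r ^ (k - j) * 1 :=
            mul_le_mul (pow_le_pow_left₀ hπ0 hr _) (pow_le_one₀ hτ0 hτ1) (pow_nonneg hτ0 _) (pow_nonneg hr0 _)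
        _ = r ^ (k - j) := mul_one _
    calc N j k * e j k ≤ (N₀ * e₀) * ((Λ * φ * τ) ^ (k - j) * τ ^ (K - k)) := h1.trans_eq h2
      _ ≤ (N₀ * e₀) * r ^ (k - j) := mul_le_mul_of_nonneg_left h3 (mul_nonneg hN₀ he₀)
  have hgeom : ∑ j ∈ range (k + 1), r ^ (k - j) ≤ (1 - r)⁻¹ := by
    have hrefl : ∑ j ∈ range (k + 1), r ^ (k - j) = ∑ i ∈ range (k + 1), r ^ i := by
      have h := sum_range_reflect (fun i => r ^ i) (k + 1)
      simpa using h
    rw [hrefl, ← tsum_geometric_of_lt_one hr0 hr1]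
    exact (summable_geometric_of_lt_one hr0 hr1).sum_le_tsum _ fun i _ => pow_nonneg hr0 i
  calc ∑ j ∈ range (k + 1), N j k * e j k ≤ ∑ j ∈ range (k + 1), (N₀ * e₀) * r ^ (k - j) := sum_le_sum hterm
    _ = (N₀ * e₀) * ∑ j ∈ range (k + 1), r ^ (k - j) := by rw [mul_sum]
    _ ≤ (N₀ * e₀) * (1 - r)⁻¹ := mul_le_mul_of_nonneg_left hgeom (mul_nonneg hN₀ he₀)
    _ = N₀ * e₀ / (1 - r) := by rw [div_eq_mul_inv]

end Slot

/-! ## §4  Why it might fail, as a theorem: a frozen first-order-in-μ draw admits no K-uniform slot -/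

/-- WHY IT MIGHT FAIL (the row's clause, kernel-exact): suppose that at every depth `K` the per-term draw of a term of
birth scale `j` felt at the top scale stays `≥ c₀ > 0` (a remainder second order in the fluctuation but first order
in `μ` with a constant that does NOT decay in `k − j`), and that at least `Λ^{K−j}` terms of birth scale `j` are felt
there with `Λ > 1` (the positional count of T4-REF-O3 V4 (α): `L^{4(k−j)}`).  Then for EVERY budget `E` some depth
`K` violates the slot `Σ_{j≤k} N j k · e j k ≤ E`.  An instance of `T4TubeBudget.not_tubeBudget_of_osc` (weights 1,
`θ = 1`, `p = 0`).  Hence the line NEEDS the decay of §3/§3b (`Transport ρ`, draw profile `φ^{k−j}`) — the open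
estimate O-γ2. [folklore] -/
theorem no_uniform_slot_of_frozen_draw {N e : ℕ → ℕ → ℕ → ℝ} {Λ c₀ : ℝ} (hΛ : 1 < Λ) (hc₀ : 0 < c₀)
    (hN0 : ∀ K, ∀ k ≤ K, ∀ j ≤ k, 0 ≤ N K j k) (he0 : ∀ K, ∀ k ≤ K, ∀ j ≤ k, 0 ≤ e K j k)
    (hN : ∀ K, ∀ j ≤ K, Λ ^ (K - j) ≤ N K j K) (he : ∀ K, ∀ j ≤ K, c₀ ≤ e K j K) (Eη : ℝ) :
    ∃ K, ¬ ∀ k ≤ K, ∑ j ∈ range (k + 1), N K j k * e K j k ≤ Eη := by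
  have hs : ∀ K, ∀ j ≤ K, c₀ * (Λ * 1) ^ (K - j) ≤ N K j K * e K j K := by
    intro K j hj
    rw [mul_one, mul_comm]
    exact mul_le_mul (hN K j hj) (he K j hj) hc₀.le ((pow_nonneg (zero_le_one.trans hΛ.le) _).trans (hN K j hj))
  obtain ⟨K, hK⟩ := T4TubeBudget.not_tubeBudget_of_osc (w := fun _ _ => (1 : ℝ))
    (s := fun K j k => N K j k * e K j k) (p := 0) (by simpa using hΛ) hc₀ one_pos (fun K j _ => zero_le_one)
    (fun K k hk j hj => mul_nonneg (hN0 K k hk j hj) (he0 K k hk j hj)) (fun K j _ => by simp) hs Eη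
  refine ⟨K, fun hB => hK ?_⟩
  intro k hk
  simpa [one_mul] using hB k hk

/-! ## §5  Non-vacuity: a non-linear function meeting the function-level shapes -/

section Example

variable {β : Type*} {E : Type*} [NormedAddCommGroup E] [InnerProductSpace ℝ E]

/-- A ONE-BOND NON-LINEAR EXAMPLE: `B ↦ t⟪a₀, B b₀⟫ + ‖B b₀‖²` (linear part with coefficient `a₀` at the bond `b₀`,
plus a genuinely second-order piece). [folklore] -/
def exampleVal (b₀ : β) (a₀ : E) (t : ℝ) : (β → E) → ℝ := fun B => t * ⟪a₀, B b₀⟫_ℝ + ‖B b₀‖ ^ 2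

/-- Its second-order remainder after re-linearising with coefficient `a₀` on `{b₀}` is `‖B b₀‖²` exactly.
[folklore] -/
theorem example_relinRem_eq (b₀ : β) (a₀ : E) (t : ℝ) (B : β → E) :
    relinRem (exampleVal b₀ a₀ t) t {b₀} (fun _ => a₀) B = ‖B b₀‖ ^ 2 := by
  simp [relinRem, exampleVal, T4FirstOrderSize.linTerm]

/-- The example meets `AmpBound` with `A = ‖a₀‖` and `RemBound` with `q = 2`, and its fluctuation part is in currency
`(η + 2, (t‖a₀‖)²/(2η))` for every `η > 0` (by `inCurrency_flucPart`): the function-level shapes are jointly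
inhabited by a non-linear function. [folklore] -/
theorem example_spec (b₀ : β) (a₀ : E) (t : ℝ) {η : ℝ} (hη : 0 < η) :
    AmpBound {b₀} (fun _ => a₀) ‖a₀‖ ∧ RemBound {b₀} 2 (relinRem (exampleVal b₀ a₀ t) t {b₀} (fun _ => a₀)) ∧
      InCurrency {b₀} (η + 2) ((t * ‖a₀‖) ^ 2 / (2 * η)) (flucPart (exampleVal b₀ a₀ t)) := by
  have hA : AmpBound {b₀} (fun _ => a₀) ‖a₀‖ := fun _ _ => le_rfl
  have hr : RemBound {b₀} 2 (relinRem (exampleVal b₀ a₀ t) t {b₀} (fun _ => a₀)) := by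
    intro B
    rw [example_relinRem_eq, sum_singleton, abs_of_nonneg (sq_nonneg _)]
    linarith [sq_nonneg ‖B b₀‖]
  exact ⟨hA, hr, inCurrency_flucPart hA hr hη⟩

end Example

end

end Literature.MathematicalPhysics.QuantumFieldTheory.Balaban1983to89.T4Relinearisation
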